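import Summits.ValiantsHypothesis.ValiantsHypothesis.Theorems.LacunarySymmetroidMatrixDescartesFiniteSectorIterMasks
import Summits.ValiantsHypothesis.ValiantsHypothesis.Theorems.LacunarySymmetroidMatrixDescartesFiniteSector

/-!
# `MatrixDescartes` — line «stamp»: the STAMP CEILING `ν(16,5) ≤ 1650 = n(16,4)` (kernel) — `StampLawAt 16 5 1650`

HONEST FRAMING.  Object-search cell `pub-symmetroid`, seat val-sym-door-p5 g11.  HELPER of the crux item `stmt-ValiantsHypothesis-18050` (`Theses.LacunarySymmetroid.MatrixDescartes`)
with NO closure claim.  T3 (`mem_sumset_of_fullPos`) makes every `r ≤ deg` of a full-positive-rooted symmetric `16 × 16` half-pencil with `5` terms an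
`16`-fold sum of exponents; the values `0, 1` occur, and the capped, padded, sorted value set must cover `[0, deg]`; the finite core — no `4` denominations
with `16` stamps cover `[0, 1651]` (`n(16,4) = 1650`) — has 190094 live prefixes and is decided in the kernel in the ITERATED-MASK shape of
`…FiniteSectorIterMasks` (seat val-sym-door-p5 g11): `16`-fold sums as iterates `(F l)^[16] 1` of the shift-or step (raw recursor, `Nat.lor` / `Nat.shiftLeft`), children of a
prefix = `takeWhile` of the cover guard over an interval, the last level incremental over the cached prefix masks; the transfer reads the census sum set as capped
multisets (`exists_multiset_of_mem_sumset`).  Result: `stampLawAt_sixteen_five : StampLawAt 16 5 1650`.  Located first (exact DFS): best reach of `4` denominations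
with `16` stamps = `1650` (e.g. {1,11,78,216}).  Nothing here bears on the crux (asymptotic), on the doors, or on `VP ≠ VNP`.
[folklore] Postage-stamp bookkeeping on the proved T3 (Guy UPINT C12; Challis / Mossige tables); no citation is load-bearing.
-/

-- `Summit.ValiantsHypothesis.ValiantsHypothesis.…` repeats a component by the D-0017 layout
-- (single-conjunct summit), which the `dupNamespace` linter flags; the name is mandated.
set_option linter.dupNamespace false

namespace Summit.ValiantsHypothesis.ValiantsHypothesis.Theorems.LacunarySymmetroidMatrixDescartes.FiniteSector

open scoped BigOperators Matrix
open Polynomial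

/-! ## `(16,5)`: `ν(16,5) ≤ n(16,4) = 1650` -/

set_option synthInstance.maxSize 2000000 in
set_option synthInstance.maxHeartbeats 2000000 in
set_option maxHeartbeats 4000000 in
/-- **Finite core of `ν(16,5) ≤ 1650`** (pruned nested enumeration over the sorted values `0, 1, a, b, c` (`< 1653`), children of a
prefix = the `takeWhile` of the cover guard, `16`-fold sums as ITERATED shift-or masks `(F l)^[16] 1`, the last level incremental; `decide` in the kernel):
prefixes covering `[0, next)` never cover `[0, 1651]`. [folklore] -/
theorem stampCheck_sixteen_five :
    ∀ a ∈ (List.Ico 2 1653).takeWhile (fun (a : ℕ) => Nat.testBit ((fun (E : ℕ) => @List.rec ℕ (fun _ => ℕ) 0 (fun (x : ℕ) (_ : List ℕ) (acc : ℕ) => Nat.lor acc (Nat.shiftLeft E x)) [0, 1])^[16] 1) (a - 1)),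
    ∀ b ∈ (List.Ico (a + 1) 1653).takeWhile (fun (b : ℕ) => Nat.testBit ((fun (E : ℕ) => @List.rec ℕ (fun _ => ℕ) 0 (fun (x : ℕ) (_ : List ℕ) (acc : ℕ) => Nat.lor acc (Nat.shiftLeft E x)) [0, 1, a])^[16] 1) (b - 1)),
    ∀ c ∈ (List.Ico (b + 1) 1653).takeWhile (fun (c : ℕ) => Nat.testBit ((fun (E : ℕ) => @List.rec ℕ (fun _ => ℕ) 0 (fun (x : ℕ) (_ : List ℕ) (acc : ℕ) => Nat.lor acc (Nat.shiftLeft E x)) [0, 1, a, b])^[16] 1) (c - 1)),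
    ¬ ((@Nat.rec (fun _ => ℕ) 1 (fun (k acc : ℕ) => Nat.lor ((fun (E : ℕ) => @List.rec ℕ (fun _ => ℕ) 0 (fun (x : ℕ) (_ : List ℕ) (acc : ℕ) => Nat.lor acc (Nat.shiftLeft E x)) [0, 1, a, b])^[k + 1] 1) (Nat.shiftLeft acc c)) 16) % 2 ^ 1652 = 2 ^ 1652 - 1) := by
  decide +kernel

set_option maxHeartbeats 4000000 in
/-- **`ν(16,5) ≤ 1650`** — `StampLawAt 16 5 1650`: every full-positive-rooted symmetric `16 × 16` half-pencil determinant with `5` terms has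
degree `≤ 1650` (T3 ⇒ every `r ≤ deg` is an `16`-fold sum of exponents; values `0, 1` forced; capped at `1652`, padded, sorted; capped multisets;
the kernel check `stampCheck_sixteen_five`). [folklore] -/
theorem stampLawAt_sixteen_five : StampLawAt 16 5 1650 := by
  intro d S hS hfull
  by_contra hdeg'
  have hdeg : 1650 < (pencil d S).det.natDegree := not_le.mp hdeg'
  have hq : (pencil d S).det ≠ 0 := by
    intro h0
    rw [h0] at hdeg
    simp at hdeg
  have hmem : ∀ r, r ≤ (pencil d S).det.natDegree → r ∈ (Finset.univ : Finset (Sym (Fin 5) 16)).image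
      (fun s : Sym (Fin 5) 16 => ((s : Multiset (Fin 5)).map d).sum) :=
    fun r hr => mem_sumset_of_fullPos d S hq hfull hr
  set cv : Fin 5 → ℕ := fun i => min (d i) 1652 with hcv
  have hcvle : ∀ i, cv i ≤ 1652 := fun i => Nat.min_le_right _ _
  set V : Finset ℕ := Finset.univ.image cv with hV
  have hcvV : ∀ i, cv i ∈ V := fun i => Finset.mem_image_of_mem cv (Finset.mem_univ i)
  have h0V : 0 ∈ V := by
    obtain ⟨i, hi⟩ := exists_index_eq_zero d 1652 (by norm_num) (by norm_num) (hmem 0 (by omega))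
    exact hi ▸ hcvV i
  have h1V : 1 ∈ V := by
    obtain ⟨i, hi⟩ := exists_index_eq_one d 1652 (by norm_num) (hmem 1 (by omega))
    exact hi ▸ hcvV i
  have h1V' : 1 ∈ V.erase 0 := Finset.mem_erase.mpr ⟨by norm_num, h1V⟩
  set W : Finset ℕ := (V.erase 0).erase 1 with hW
  have hWsub : W ⊆ ((Finset.range 1653).erase 0).erase 1 := by
    intro u hu
    rw [hW, Finset.mem_erase, Finset.mem_erase] at hu
    obtain ⟨hu1, hu0, huV⟩ := hu
    rw [hV, Finset.mem_image] at huV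
    obtain ⟨i, -, rfl⟩ := huV
    rw [Finset.mem_erase, Finset.mem_erase, Finset.mem_range]
    exact ⟨hu1, hu0, Nat.lt_succ_of_le (hcvle i)⟩
  have hWcard : W.card ≤ 3 := by
    have hVK : V.card ≤ 5 := by
      have := Finset.card_image_le (s := (Finset.univ : Finset (Fin 5))) (f := cv)
      simpa using this
    have h1 : (V.erase 0).card + 1 = V.card := Finset.card_erase_add_one h0V
    have h2 : W.card + 1 = (V.erase 0).card := by rw [hW]; exact Finset.card_erase_add_one h1V'
    omega
  obtain ⟨W', hWW', hW'sub, hW'card⟩ := Finset.exists_subsuperset_card_eq hWsub hWcard (by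
    rw [Finset.card_erase_of_mem (by simp), Finset.card_erase_of_mem (by simp), Finset.card_range]; omega)
  have hVW' : ∀ u ∈ V, u = 0 ∨ u = 1 ∨ u ∈ W' := by
    intro u hu
    by_cases hu0 : u = 0
    · exact Or.inl hu0
    by_cases hu1 : u = 1
    · exact Or.inr (Or.inl hu1)
    · exact Or.inr (Or.inr (hWW' (by rw [hW, Finset.mem_erase, Finset.mem_erase]; exact ⟨hu1, hu0, hu⟩)))
  have hlmem : ∀ u, u ∈ Finset.sort W' ↔ u ∈ W' := fun u => Finset.mem_sort _
  have hlsort : (Finset.sort W').SortedLT := Finset.sortedLT_sort W'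
  have hllen : (Finset.sort W').length = 3 := by rw [Finset.length_sort, hW'card]
  generalize hl : Finset.sort W' = l at hlmem hlsort hllen
  rcases l with _ | ⟨a, _ | ⟨b, _ | ⟨c, _ | ⟨zz, ll⟩⟩⟩⟩
  all_goals simp only [List.length_cons, List.length_nil] at hllen
  all_goals try omega
  have hltC : ∀ u, u ∈ [a, b, c] → u < 1653 := by
    intro u hu
    have hu' : u ∈ W' := (hlmem u).mp hu
    have := hW'sub hu'
    rw [Finset.mem_erase, Finset.mem_erase, Finset.mem_range] at this
    exact this.2.2
  have hgt1 : ∀ u, u ∈ [a, b, c] → 1 < u := by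
    intro u hu
    have hu' : u ∈ W' := (hlmem u).mp hu
    have := hW'sub hu'
    rw [Finset.mem_erase, Finset.mem_erase] at this
    omega
  have h1a : 1 < a := hgt1 a (by simp)
  have hin : ∀ u ∈ V, u ∈ [0, 1, a, b, c] := by
    intro u hu
    rcases hVW' u hu with h | h | h
    · rw [h]; simp
    · rw [h]; simp
    · exact List.mem_cons_of_mem _ (List.mem_cons_of_mem _ ((hlmem u).mpr h))
  have hL : ∀ i, min (d i) 1652 ∈ [0, 1, a, b, c] := fun i => by
    have := hin _ (hcvV i)
    simpa only [hcv] using this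
  have hcovP : ∀ r, r ≤ 1651 → ∃ t : Multiset ℕ, (∀ x ∈ t, x ∈ [0, 1, a, b, c]) ∧ Multiset.card t = 16 ∧ t.sum = r := by
    intro r hr
    have hr' := hmem r (le_trans hr hdeg)
    have key := exists_multiset_of_mem_sumset d 1652 [0, 1, a, b, c] hL (Nat.lt_succ_of_le hr) hr'
    exact key
  have hlt1 : a < b := by
    have := hlsort (show (⟨0, by simp⟩ : Fin [a, b, c].length) < ⟨1, by simp⟩ from Fin.mk_lt_mk.mpr (by norm_num))
    simpa using this
  have hlt2 : b < c := by
    have := hlsort (show (⟨1, by simp⟩ : Fin [a, b, c].length) < ⟨2, by simp⟩ from Fin.mk_lt_mk.mpr (by norm_num))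
    simpa using this
  have hrest0 : ∀ y ∈ [a, b, c], a ≤ y := by
    intro y hy
    simp only [List.mem_cons, List.mem_nil_iff, or_false] at hy
    omega
  have hcov0 : ∀ r < min 1652 a, (((fun (E : ℕ) => @List.rec ℕ (fun _ => ℕ) 0 (fun (x : ℕ) (_ : List ℕ) (acc : ℕ) => Nat.lor acc (Nat.shiftLeft E x)) [0, 1])^[16] 1)).testBit r = true := by
    intro r hr
    obtain ⟨t, ht, hcard, hsum⟩ := hcovP r (by omega)
    have ht' := multiset_prefix (l₁ := [0, 1]) (l₂ := [a, b, c]) hrest0 (by omega) ht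
    rw [← hsum]
    exact testBit_iterMask_of_multiset' [0, 1] 16 t ht' hcard
  have hrest1 : ∀ y ∈ [b, c], b ≤ y := by
    intro y hy
    simp only [List.mem_cons, List.mem_nil_iff, or_false] at hy
    omega
  have hcov1 : ∀ r < min 1652 b, (((fun (E : ℕ) => @List.rec ℕ (fun _ => ℕ) 0 (fun (x : ℕ) (_ : List ℕ) (acc : ℕ) => Nat.lor acc (Nat.shiftLeft E x)) [0, 1, a])^[16] 1)).testBit r = true := by
    intro r hr
    obtain ⟨t, ht, hcard, hsum⟩ := hcovP r (by omega)
    have ht' := multiset_prefix (l₁ := [0, 1, a]) (l₂ := [b, c]) hrest1 (by omega) ht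
    rw [← hsum]
    exact testBit_iterMask_of_multiset' [0, 1, a] 16 t ht' hcard
  have hrest2 : ∀ y ∈ [c], c ≤ y := by
    intro y hy
    simp only [List.mem_cons, List.mem_nil_iff, or_false] at hy
    omega
  have hcov2 : ∀ r < min 1652 c, (((fun (E : ℕ) => @List.rec ℕ (fun _ => ℕ) 0 (fun (x : ℕ) (_ : List ℕ) (acc : ℕ) => Nat.lor acc (Nat.shiftLeft E x)) [0, 1, a, b])^[16] 1)).testBit r = true := by
    intro r hr
    obtain ⟨t, ht, hcard, hsum⟩ := hcovP r (by omega)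
    have ht' := multiset_prefix (l₁ := [0, 1, a, b]) (l₂ := [c]) hrest2 (by omega) ht
    rw [← hsum]
    exact testBit_iterMask_of_multiset' [0, 1, a, b] 16 t ht' hcard
  have hm0 : a ∈ (List.Ico 2 1653).takeWhile (fun (a : ℕ) => Nat.testBit ((fun (E : ℕ) => @List.rec ℕ (fun _ => ℕ) 0 (fun (x : ℕ) (_ : List ℕ) (acc : ℕ) => Nat.lor acc (Nat.shiftLeft E x)) [0, 1])^[16] 1) (a - 1)) :=
    mem_takeWhile_cover (lo := 1) h1a (hltC a (by simp)) le_rfl hcov0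
  have hm1 : b ∈ (List.Ico (a + 1) 1653).takeWhile (fun (b : ℕ) => Nat.testBit ((fun (E : ℕ) => @List.rec ℕ (fun _ => ℕ) 0 (fun (x : ℕ) (_ : List ℕ) (acc : ℕ) => Nat.lor acc (Nat.shiftLeft E x)) [0, 1, a])^[16] 1) (b - 1)) :=
    mem_takeWhile_cover hlt1 (hltC b (by simp)) le_rfl hcov1
  have hm2 : c ∈ (List.Ico (b + 1) 1653).takeWhile (fun (c : ℕ) => Nat.testBit ((fun (E : ℕ) => @List.rec ℕ (fun _ => ℕ) 0 (fun (x : ℕ) (_ : List ℕ) (acc : ℕ) => Nat.lor acc (Nat.shiftLeft E x)) [0, 1, a, b])^[16] 1) (c - 1)) :=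
    mem_takeWhile_cover hlt2 (hltC c (by simp)) le_rfl hcov2
  have hleaf : ((@Nat.rec (fun _ => ℕ) 1 (fun (k acc : ℕ) => Nat.lor ((fun (E : ℕ) => @List.rec ℕ (fun _ => ℕ) 0 (fun (x : ℕ) (_ : List ℕ) (acc : ℕ) => Nat.lor acc (Nat.shiftLeft E x)) [0, 1, a, b])^[k + 1] 1) (Nat.shiftLeft acc c)) 16) % 2 ^ 1652 = 2 ^ 1652 - 1) := by
    apply maskFull_of_testBit
    intro r hr
    obtain ⟨t, ht, hcard, hsum⟩ := hcovP r (by omega)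
    rw [← hsum]
    exact testBit_incMask_of_multiset [0, 1, a, b] c 16 t ht hcard
  exact stampCheck_sixteen_five a hm0 b hm1 c hm2 hleaf

end Summit.ValiantsHypothesis.ValiantsHypothesis.Theorems.LacunarySymmetroidMatrixDescartes.FiniteSector
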